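import Summits.QuantumFields.YangMills.Theorems.BalabanUVNodesN15CurvedAdjointLettersOfReg335UN
import HarnessLib

/-!
# N15 = NE2, road (c) — PROGRAMME (PC), (PC-E-K) ENTRY 2 «`G′(U)∇*_U` of [B9] (3.42), TWO GRIDS»: THE QUOTIENT ∕ STEP ∕ TRANSPORTER ALGEBRA OF THE PAIRING FITS — the Leibniz
# rule for `∇(χ̃•a)` across King's pairing, the one-step difference of a bump-smeared coefficient, the transporter shapes `R_E`, `B_E` of the right factor `D*_{U,ν}` read as
# first-order coefficients (dag-n15-c g38, n15-c∕431b)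

Cell `pub-ymgap`, seat `pub-ymgap-dag-n15-c` (generation g38; R134 (a), s1; HUMAN RULING D-0062).  `bears_on: R4∕N15 · K3⁸ SpineGivenEndpointR13SepCoPHV (stmt-QuantumFields-27366)`;
filed `--kind proof --supports stmt-QuantumFields-27366 --as helper` — COUNT-NEUTRAL.  Theorems only ([folklore] finite-sum algebra); 0 `def`, 0 `sorry`.  Imports n15-c∕285
`…CurvedAdjointLettersOfReg335UN` only for `tCoefA`, `gaugePair`, `fgradMat` and Mathlib.  Nothing in the tree is modified; nothing restated.

WHY.  The two-grid η-defect of entry 2 (n15-c∕430 `uN_idef_scAdjGreen_tr`) displays, beyond the bump-SMEARED value fits treated by n15-c∕431a, (i) the SHIFTED smeared fits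
`hfAsh1∕hfAsh2` (n15-c∕431a `rowSum_shift_fit_of_cross` wants the one-step difference of `χ̃•a` — §1 here), (ii) the QUOTIENT fits `hfgAf∕hfgAb` of `∇_μ(χ̃_k•a^±_μ)` across the
pairing — by the Leibniz rule `∇(χ̃•a)(y) = (∇χ̃)(y)•a(y+e) + χ̃(y)•(∇a)(y)` (resp. `= (∇χ̃)(y)•a(y) + χ̃(y+e)•(∇a)(y)`) the fit splits into FOUR guarded terms: bump-quotient fit ×
coefficient row, bump-quotient × SHIFTED value fit, bump fit × quotient row, bump × QUOTIENT fit (§2; every term is guarded by the non-vanishing of its weight, so the consumer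
proves the rows only near the box), and (iii) the transporter fits `hfRE∕hfRE′∕hfBE` of the right factor's letters `R_E(y) = −W(y)·T(y−e_ν)ᵀ·W(y−e_ν)ᵀ`,
`B_E(y) = η⁻¹(W(y)T(y−e_ν)ᵀW(y−e_ν)ᵀ − 1)` (n15-c∕284's covariant shape of `D*_{U,ν}`): with `W(y)T(y)W(y+e_ν)ᵀ = S_ν(y)` (n15-c∕285 `uN_conj_coordMat_eq`) these are
`R_E(y+e_ν) = −S_ν(y)ᵀ`, `∇_νR_E(y) = −η⁻¹(S_ν(y) − S_ν(y−e_ν))ᵀ·(nη)`, `B_E = −a⁻_ν` EXACTLY (§3) — so `hfBE` IS the sharp value fit of `a⁻_ν`, and `hfRE`, `hfRE′` are `O(η)` from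
the pointwise (3.35) letters with the aligned cuts `χ′ = χ∘π` (§4).  The quotient fit of `a^±` itself at the displayed points is n15-c∕369's PAIRWISE second-difference fit `hB`
(`sc_hB_of_pairwiseLetters`) read through §3's entry identities — no new estimate.

HONEST FRAMING ∕ LIMITS.  Finite-sum algebra; no analytic content; nothing of [B5]∕[B6]∕[B9] asserted ((3.51)–(3.53) p.400, (3.62)–(3.65) pp.402–403 = SHAPES of the objects the
letters refer to).  NE2⁺ NOT PRINTED, NOT proved; N15 of record untouched (DISCHARGED AS CONSUMED, p687738); K3⁸ OPEN; counts of record UNMOVED (typed 28∕28 · discharged 8∕27);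
one finite 𝕋⁴ at fixed ε per index — NOT infinite volume, NOT OS on ℝ⁴, NOT a mass gap, NOT Clay.  Restate-immune (no Theses import).
-/

noncomputable section

open scoped BigOperators Matrix

namespace Summit.QuantumFields.YangMills.BalabanUVNodes.N15.Gluing

open Summit.QuantumFields.YangMills.BalabanUVNodes.N15.BackgroundLayer (tCoefA tCoefA_inl tCoefA_inr fgradMat)
open Summit.QuantumFields.YangMills.BalabanUVNodes.N15.CurvedSpecies (gaugePair gaugePair_inl gaugePair_inr)

/-! ## §0 Row-sum bookkeeping -/

section Rows

variable {κ : Type} [Fintype κ]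

/-- [folklore] triangle inequality for row sums through a middle matrix. -/
theorem rowSum_sub_le_of_mid (A B C : Matrix κ κ ℝ) (i : κ) : ∑ j, |(A - C) i j| ≤ ∑ j, |(A - B) i j| + ∑ j, |(B - C) i j| := by
  rw [← Finset.sum_add_distrib]
  exact Finset.sum_le_sum fun j _ => by
    rw [show (A - C) i j = (A - B) i j + (B - C) i j by simp only [Matrix.sub_apply]; ring]; exact abs_add_le _ _

/-- [folklore] row sums of a difference are symmetric. -/
theorem rowSum_sub_comm (A B : Matrix κ κ ℝ) (i : κ) : ∑ j, |(A - B) i j| = ∑ j, |(B - A) i j| :=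
  Finset.sum_congr rfl fun j _ => by rw [Matrix.sub_apply, Matrix.sub_apply, abs_sub_comm]

/-- [folklore] a row sum from an entry bound: `Σ_j |M_{ij}| ≤ |κ|·ε`. -/
theorem rowSum_le_card_mul_of_entry {M : Matrix κ κ ℝ} {ε : ℝ} (i : κ) (h : ∀ j, |M i j| ≤ ε) : ∑ j, |M i j| ≤ Fintype.card κ * ε :=
  (Finset.sum_le_sum fun j _ => h j).trans (by rw [Finset.sum_const, Finset.card_univ, nsmul_eq_mul])

/-- [folklore] the row sum of a scalar multiple. -/
theorem rowSum_smul (c : ℝ) (A : Matrix κ κ ℝ) (i : κ) : ∑ j, |(c • A) i j| = |c| * ∑ j, |A i j| := by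
  rw [Finset.mul_sum]; exact Finset.sum_congr rfl fun j _ => by rw [Matrix.smul_apply, smul_eq_mul, abs_mul]

end Rows

/-! ## §1 The one-step difference of a bump-smeared coefficient -/

section Step

variable {κ : Type} [Fintype κ]

/-- ★ **THE STEP OF A SMEARED COEFFICIENT, GUARDED**: `Σ_j |(b₁•A₁ − b₀•A₀)_{ij}| ≤ c·r_V + c₀·s` when `|b₁ − b₀| ≤ c`, `|b₀| ≤ c₀`, the row of `A₁` is `≤ r_V` PROVIDED one of
the weights is non-zero, and the row of `A₁ − A₀` is `≤ s` PROVIDED `b₀ ≠ 0` (n15-c∕431a `rowSum_shift_fit_of_cross`'s `hstep` for `f = χ̃_k•a^±_μ`: both weights vanish far from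
the box, and near it the rows come from the (3.35) letters). [cite: Balaban1985BackgroundPropagators, (3.51)–(3.53) p.400, (3.62)–(3.65) pp.402–403 (shapes)] -/
theorem rowSum_smul_step_le (b₀ b₁ : ℝ) (A₀ A₁ : Matrix κ κ ℝ) {c c₀ rV s : ℝ} (hc : 0 ≤ c) (hc₀ : 0 ≤ c₀) (hrV : 0 ≤ rV) (hs : 0 ≤ s)
    (hb : |b₁ - b₀| ≤ c) (hb0 : |b₀| ≤ c₀) (i : κ) (h1 : b₁ ≠ 0 ∨ b₀ ≠ 0 → ∑ j, |A₁ i j| ≤ rV) (h2 : b₀ ≠ 0 → ∑ j, |(A₁ - A₀) i j| ≤ s) :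
    ∑ j, |(b₁ • A₁ - b₀ • A₀) i j| ≤ c * rV + c₀ * s := by
  by_cases h0 : b₀ = 0
  · by_cases h1' : b₁ = 0
    · have hz : ∀ j, |(b₁ • A₁ - b₀ • A₀) i j| = 0 := fun j => by rw [h0, h1', zero_smul, zero_smul, sub_self, Matrix.zero_apply, abs_zero]
      rw [Finset.sum_congr rfl fun j _ => hz j, Finset.sum_const_zero]; positivity
    · rw [h0, zero_smul, sub_zero, rowSum_smul]
      rw [h0, sub_zero] at hb
      exact (mul_le_mul hb (h1 (Or.inl h1')) (Finset.sum_nonneg fun j _ => abs_nonneg _) hc).trans (le_add_of_nonneg_right (mul_nonneg hc₀ hs))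
  · have hdec : b₁ • A₁ - b₀ • A₀ = (b₁ - b₀) • A₁ + b₀ • (A₁ - A₀) := by rw [sub_smul, smul_sub]; abel
    rw [hdec]
    calc ∑ j, |((b₁ - b₀) • A₁ + b₀ • (A₁ - A₀)) i j| ≤ ∑ j, (|((b₁ - b₀) • A₁) i j| + |(b₀ • (A₁ - A₀)) i j|) := Finset.sum_le_sum fun j _ => abs_add_le _ _
      _ = |b₁ - b₀| * ∑ j, |A₁ i j| + |b₀| * ∑ j, |(A₁ - A₀) i j| := by rw [Finset.sum_add_distrib, rowSum_smul, rowSum_smul]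
      _ ≤ c * rV + c₀ * s := add_le_add (mul_le_mul hb (h1 (Or.inr h0)) (Finset.sum_nonneg fun j _ => abs_nonneg _) hc) (mul_le_mul hb0 (h2 h0) (Finset.sum_nonneg fun j _ => abs_nonneg _) hc₀)

end Step

/-! ## §2 The quotient fit of a bump-smeared coefficient across the pairing: Leibniz, four guarded terms -/

section Quotient

variable {X X' κ : Type} [Fintype κ]

omit [Fintype κ] in
/-- [folklore] THE LEIBNIZ RULE, shifted value form: `∇(b•A)(y) = (n(b(ey) − b(y)))•A(ey) + b(y)•(∇A)(y)`. -/
theorem fgradMat_smul_eq (n : ℝ) (e : X ≃ X) (b : X → ℝ) (A : X → Matrix κ κ ℝ) (y : X) :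
    fgradMat n e (fun z => b z • A z) y = (n * (b (e y) - b y)) • A (e y) + b y • fgradMat n e A y := by
  ext i j; simp only [fgradMat, Matrix.smul_apply, Matrix.sub_apply, Matrix.add_apply, smul_eq_mul]; ring

omit [Fintype κ] in
/-- [folklore] THE LEIBNIZ RULE, shifted weight form: `∇(b•A)(y) = (n(b(ey) − b(y)))•A(y) + b(ey)•(∇A)(y)`. -/
theorem fgradMat_smul_eq' (n : ℝ) (e : X ≃ X) (b : X → ℝ) (A : X → Matrix κ κ ℝ) (y : X) :
    fgradMat n e (fun z => b z • A z) y = (n * (b (e y) - b y)) • A y + b (e y) • fgradMat n e A y := by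
  ext i j; simp only [fgradMat, Matrix.smul_apply, Matrix.sub_apply, Matrix.add_apply, smul_eq_mul]; ring

/-- [folklore] the four-term bound behind both Leibniz forms: `Σ_j |(g′•P′ + b′•D′ − (g•P + b•D))_{ij}| ≤ o₂·r_V + c_t·o_A + o_χ·r_D + o_D` under the guarded rows. -/
theorem rowSum_leibniz_four_le {g' g b' b : ℝ} {P' P D' D : Matrix κ κ ℝ} {o₂ ct oχ rV oA rD oD : ℝ}
    (ho₂ : 0 ≤ o₂) (hct : 0 ≤ ct) (hoχ : 0 ≤ oχ) (hrV : 0 ≤ rV) (hoA : 0 ≤ oA) (hrD : 0 ≤ rD) (hoD : 0 ≤ oD)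
    (hg : |g' - g| ≤ o₂) (hgc : |g| ≤ ct) (hb : |b' - b| ≤ oχ) (hb1 : |b| ≤ 1) (i : κ)
    (h1 : g' ≠ 0 ∨ g ≠ 0 → ∑ j, |P' i j| ≤ rV) (h2 : g ≠ 0 → ∑ j, |(P' - P) i j| ≤ oA)
    (h3 : b' ≠ 0 ∨ b ≠ 0 → ∑ j, |D' i j| ≤ rD) (h4 : b ≠ 0 → ∑ j, |(D' - D) i j| ≤ oD) :
    ∑ j, |(g' • P' + b' • D' - (g • P + b • D)) i j| ≤ o₂ * rV + ct * oA + oχ * rD + oD := by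
  have hsplit : g' • P' + b' • D' - (g • P + b • D) = (g' • P' - g • P) + (b' • D' - b • D) := by abel
  have hA : ∑ j, |(g' • P' - g • P) i j| ≤ o₂ * rV + ct * oA := rowSum_smul_step_le g g' P P' ho₂ hct hrV hoA hg hgc i h1 h2
  have hB : ∑ j, |(b' • D' - b • D) i j| ≤ oχ * rD + 1 * oD := rowSum_smul_step_le b b' D D' hoχ zero_le_one hrD hoD hb hb1 i h3 h4
  rw [hsplit]
  calc ∑ j, |((g' • P' - g • P) + (b' • D' - b • D)) i j| ≤ ∑ j, (|(g' • P' - g • P) i j| + |(b' • D' - b • D) i j|) := Finset.sum_le_sum fun j _ => abs_add_le _ _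
    _ ≤ (o₂ * rV + ct * oA) + (oχ * rD + 1 * oD) := by rw [Finset.sum_add_distrib]; exact add_le_add hA hB
    _ = o₂ * rV + ct * oA + oχ * rD + oD := by ring

/-- ★★ **THE QUOTIENT FIT OF A BUMP-SMEARED COEFFICIENT ACROSS THE PAIRING, shifted value form** (n15-c∕430's `hfgAb` at `(x′, πx′)`): by `∇(b•A)(y) = g•A(ey) + b(y)•(∇A)(y)`,
`g = n(b(ey) − b(y))`, the two-grid difference is bounded by `o₂·r_V + c_t·o_A + o_χ·r_D + o_D` from the bump-quotient fit `|g′ − g| ≤ o₂`, the bump-quotient size `|g| ≤ c_t`,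
the bump fit `|b′(y′) − b(y)| ≤ o_χ`, `|b| ≤ 1`, and the GUARDED rows: `A′(e′y′)` (`≤ r_V`, if a quotient weight is live), the SHIFTED value fit `A′(e′y′) − A(ey)` (`≤ o_A`, if `g ≠ 0`),
`∇′A′(y′)` (`≤ r_D`, if a bump weight is live), the QUOTIENT fit `∇′A′(y′) − ∇A(y)` (`≤ o_D`, if `b(y) ≠ 0`).
[cite: Balaban1985BackgroundPropagators, Thm 3.14 pp.426–427 (two-grid difference: template), (3.51)–(3.53) p.400, (3.62)–(3.65) pp.402–403 (shapes)] -/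
theorem rowSum_fgradMat_smul_fit_le (n' n : ℝ) (e' : X' ≃ X') (e : X ≃ X) (b' : X' → ℝ) (b : X → ℝ) (A' : X' → Matrix κ κ ℝ) (A : X → Matrix κ κ ℝ) (y' : X') (y : X)
    {o₂ ct oχ rV oA rD oD : ℝ} (ho₂ : 0 ≤ o₂) (hct : 0 ≤ ct) (hoχ : 0 ≤ oχ) (hrV : 0 ≤ rV) (hoA : 0 ≤ oA) (hrD : 0 ≤ rD) (hoD : 0 ≤ oD)
    (hg : |n' * (b' (e' y') - b' y') - n * (b (e y) - b y)| ≤ o₂) (hgc : |n * (b (e y) - b y)| ≤ ct) (hb : |b' y' - b y| ≤ oχ) (hb1 : |b y| ≤ 1) (i : κ)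
    (h1 : n' * (b' (e' y') - b' y') ≠ 0 ∨ n * (b (e y) - b y) ≠ 0 → ∑ j, |A' (e' y') i j| ≤ rV) (h2 : n * (b (e y) - b y) ≠ 0 → ∑ j, |(A' (e' y') - A (e y)) i j| ≤ oA)
    (h3 : b' y' ≠ 0 ∨ b y ≠ 0 → ∑ j, |fgradMat n' e' A' y' i j| ≤ rD) (h4 : b y ≠ 0 → ∑ j, |(fgradMat n' e' A' y' - fgradMat n e A y) i j| ≤ oD) :
    ∑ j, |(fgradMat n' e' (fun z => b' z • A' z) y' - fgradMat n e (fun z => b z • A z) y) i j| ≤ o₂ * rV + ct * oA + oχ * rD + oD := by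
  rw [fgradMat_smul_eq, fgradMat_smul_eq]
  exact rowSum_leibniz_four_le ho₂ hct hoχ hrV hoA hrD hoD hg hgc hb hb1 i h1 h2 h3 h4

/-- ★★ **THE QUOTIENT FIT OF A BUMP-SMEARED COEFFICIENT ACROSS THE PAIRING, shifted weight form** (n15-c∕430's `hfgAf` at `(x′ − e′_μ, πx′ − e_μ)`): by
`∇(b•A)(y) = g•A(y) + b(ey)•(∇A)(y)`, the same four guarded terms with the value `A′(y′)` ∕ value fit `A′(y′) − A(y)` and the weights `b′(e′y′)`, `b(ey)`.
[cite: Balaban1985BackgroundPropagators, Thm 3.14 pp.426–427 (two-grid difference: template), (3.51)–(3.53) p.400, (3.62)–(3.65) pp.402–403 (shapes)] -/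
theorem rowSum_fgradMat_smul_fit_le' (n' n : ℝ) (e' : X' ≃ X') (e : X ≃ X) (b' : X' → ℝ) (b : X → ℝ) (A' : X' → Matrix κ κ ℝ) (A : X → Matrix κ κ ℝ) (y' : X') (y : X)
    {o₂ ct oχ rV oA rD oD : ℝ} (ho₂ : 0 ≤ o₂) (hct : 0 ≤ ct) (hoχ : 0 ≤ oχ) (hrV : 0 ≤ rV) (hoA : 0 ≤ oA) (hrD : 0 ≤ rD) (hoD : 0 ≤ oD)
    (hg : |n' * (b' (e' y') - b' y') - n * (b (e y) - b y)| ≤ o₂) (hgc : |n * (b (e y) - b y)| ≤ ct) (hb : |b' (e' y') - b (e y)| ≤ oχ) (hb1 : |b (e y)| ≤ 1) (i : κ)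
    (h1 : n' * (b' (e' y') - b' y') ≠ 0 ∨ n * (b (e y) - b y) ≠ 0 → ∑ j, |A' y' i j| ≤ rV) (h2 : n * (b (e y) - b y) ≠ 0 → ∑ j, |(A' y' - A y) i j| ≤ oA)
    (h3 : b' (e' y') ≠ 0 ∨ b (e y) ≠ 0 → ∑ j, |fgradMat n' e' A' y' i j| ≤ rD) (h4 : b (e y) ≠ 0 → ∑ j, |(fgradMat n' e' A' y' - fgradMat n e A y) i j| ≤ oD) :
    ∑ j, |(fgradMat n' e' (fun z => b' z • A' z) y' - fgradMat n e (fun z => b z • A z) y) i j| ≤ o₂ * rV + ct * oA + oχ * rD + oD := by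
  rw [fgradMat_smul_eq', fgradMat_smul_eq']
  exact rowSum_leibniz_four_le ho₂ hct hoχ hrV hoA hrD hoD hg hgc hb hb1 i h1 h2 h3 h4

end Quotient

/-! ## §3 The transporter letters of `D*_{U,ν}` are first-order coefficients; the quotients of `a^±` in entries -/

section Transporter

variable {X J κ : Type} [Fintype κ] [DecidableEq κ] (τ : J → X ≃ X) (ν : J)

omit [Fintype κ] [DecidableEq κ] in
/-- ★ `R_E(y + e_ν) = −S_ν(y)ᵀ` for `R_E(y) := −W(y)T(y−e_ν)ᵀW(y−e_ν)ᵀ`, given `W(y)T(y)W(y+e_ν)ᵀ = S_ν(y)` (n15-c∕284's covariant shape of `D*_{U,ν}` read through n15-c∕285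
`uN_conj_coordMat_eq`). [cite: Balaban1985BackgroundPropagators, (3.51)–(3.52) p.400 (shape); Balaban1984PropagatorsII, (2.93) p.239 (shape)] -/
theorem transporterRE_shift_apply [Fintype κ] (W T : X → Matrix κ κ ℝ) (S : J → X → Matrix κ κ ℝ) (hWS : ∀ y, W y * T y * (W (τ ν y))ᵀ = S ν y) (x : X) :
    ((fun y => -(W y * (T ((τ ν).symm y))ᵀ * (W ((τ ν).symm y))ᵀ)) ∘ ⇑(τ ν)) x = -(S ν x)ᵀ := by
  simp only [Function.comp_apply, Equiv.symm_apply_apply]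
  rw [← hWS x, Matrix.transpose_mul, Matrix.transpose_mul, Matrix.transpose_transpose, Matrix.mul_assoc]

omit [DecidableEq κ] in
/-- ★ `∇_νR_E(x) = −(n•(S_ν(x) − S_ν(x−e_ν)))ᵀ`. [cite: Balaban1985BackgroundPropagators, (3.51)–(3.52) p.400 (shape)] -/
theorem fgradMat_transporterRE_apply (W T : X → Matrix κ κ ℝ) (S : J → X → Matrix κ κ ℝ) (hWS : ∀ y, W y * T y * (W (τ ν y))ᵀ = S ν y) (n : ℝ) (x : X) :
    fgradMat n (τ ν) (fun y => -(W y * (T ((τ ν).symm y))ᵀ * (W ((τ ν).symm y))ᵀ)) x = -(n • (S ν x - S ν ((τ ν).symm x)))ᵀ := by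
  have h1 : W (τ ν x) * (T ((τ ν).symm (τ ν x)))ᵀ * (W ((τ ν).symm (τ ν x)))ᵀ = (S ν x)ᵀ := by
    rw [Equiv.symm_apply_apply, ← hWS x, Matrix.transpose_mul, Matrix.transpose_mul, Matrix.transpose_transpose, Matrix.mul_assoc]
  have h2 : W x * (T ((τ ν).symm x))ᵀ * (W ((τ ν).symm x))ᵀ = (S ν ((τ ν).symm x))ᵀ := by
    have h := hWS ((τ ν).symm x)
    rw [Equiv.apply_symm_apply] at h
    rw [← h, Matrix.transpose_mul, Matrix.transpose_mul, Matrix.transpose_transpose, Matrix.mul_assoc]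
  ext i j; simp only [fgradMat, h1, h2, Matrix.smul_apply, Matrix.sub_apply, Matrix.neg_apply, Matrix.transpose_apply, smul_eq_mul]; ring

/-- ★ `B_E = −a⁻_ν` EXACTLY: `η⁻¹(W(x)T(x−e_ν)ᵀW(x−e_ν)ᵀ − 1) = −(η⁻¹(1 − S_ν(x−e_ν)ᵀ)) = −tCoefA η (gaugePair τ S) (inr ν) x`.
[cite: Balaban1985BackgroundPropagators, (3.51)–(3.52) p.400 (the backward coefficient `a⁻`: shape)] -/
theorem transporterBE_eq_neg_tCoefA_inr (W T : X → Matrix κ κ ℝ) (S : J → X → Matrix κ κ ℝ) (hWS : ∀ y, W y * T y * (W (τ ν y))ᵀ = S ν y) {n η : ℝ} (hn : η⁻¹ = n) (x : X) :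
    n • (W x * (T ((τ ν).symm x))ᵀ * (W ((τ ν).symm x))ᵀ - 1) = -(tCoefA η (gaugePair τ S) (Sum.inr ν) x) := by
  have h2 : W x * (T ((τ ν).symm x))ᵀ * (W ((τ ν).symm x))ᵀ = (S ν ((τ ν).symm x))ᵀ := by
    have h := hWS ((τ ν).symm x)
    rw [Equiv.apply_symm_apply] at h
    rw [← h, Matrix.transpose_mul, Matrix.transpose_mul, Matrix.transpose_transpose, Matrix.mul_assoc]
  rw [h2, tCoefA_inr, gaugePair_inr, hn, ← smul_neg, neg_sub]

omit [Fintype κ] in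
/-- ★ the quotient of the FORWARD coefficient one step back, in entries: `(∇_μa⁺_μ)(x − e_μ)_{ij} = n·η⁻¹·(S_μ(x) − S_μ(x−e_μ))_{ij}`. [cite: Balaban1985BackgroundPropagators, (3.51)–(3.52) p.400 (shape)] -/
theorem fgradMat_tCoefA_inl_symm_apply (n η : ℝ) (S : J → X → Matrix κ κ ℝ) (μ : J) (x : X) (i j : κ) :
    fgradMat n (τ μ) (tCoefA η (gaugePair τ S) (Sum.inl μ)) ((τ μ).symm x) i j = n * η⁻¹ * (S μ x - S μ ((τ μ).symm x)) i j := by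
  simp only [fgradMat, tCoefA_inl, gaugePair_inl, Equiv.apply_symm_apply, Matrix.smul_apply, Matrix.sub_apply, smul_eq_mul]; ring

omit [Fintype κ] in
/-- ★ the quotient of the BACKWARD coefficient, in entries: `(∇_μa⁻_μ)(x)_{ij} = −n·η⁻¹·(S_μ(x) − S_μ(x−e_μ))_{ji}`. [cite: Balaban1985BackgroundPropagators, (3.51)–(3.52) p.400 (shape)] -/
theorem fgradMat_tCoefA_inr_apply' (n η : ℝ) (S : J → X → Matrix κ κ ℝ) (μ : J) (x : X) (i j : κ) :
    fgradMat n (τ μ) (tCoefA η (gaugePair τ S) (Sum.inr μ)) x i j = -(n * η⁻¹ * (S μ x - S μ ((τ μ).symm x)) j i) := by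
  simp only [fgradMat, tCoefA_inr, gaugePair_inr, Equiv.symm_apply_apply, Matrix.smul_apply, Matrix.sub_apply, Matrix.transpose_apply, smul_eq_mul]; ring

omit [DecidableEq κ] in
/-- ★ the one-step differences of `a^±` are `η`-multiples of their quotients: `a⁺(x−e) − a⁺(x) = −n⁻¹•(∇a⁺)(x−e)`, `a⁻(ex) − a⁻(x) = n⁻¹•(∇a⁻)(x)` — in row sums. [folklore] -/
theorem rowSum_sub_eq_inv_mul_rowSum_fgradMat {n : ℝ} (hn : n ≠ 0) (e : X ≃ X) (A : X → Matrix κ κ ℝ) (y : X) (i : κ) :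
    ∑ j, |(A (e y) - A y) i j| = |n⁻¹| * ∑ j, |fgradMat n e A y i j| := by
  rw [← rowSum_smul]; exact Finset.sum_congr rfl fun j _ => by rw [fgradMat, smul_smul, inv_mul_cancel₀ hn, one_smul]

end Transporter

/-! ## §4 The transporter fits across the pairing with aligned cuts -/

section TransporterFits

variable {X X' J κ : Type} [Fintype κ] [DecidableEq κ] (π : X' → X) (τ' : J → X' ≃ X') (τ : J → X ≃ X) (ν : J)

/-- ★★ **`hfRE`**: with aligned cuts `χ′ = χ∘π`, `|χ| ≤ 1`, and the pointwise letters `|(S′_ν(x′) − 1)_{ij}| ≤ ε′` (where `χ′(x′) ≠ 0`), `|(S_ν(πx′) − 1)_{ij}| ≤ ε` (where `χ(πx′) ≠ 0`):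
`Σ_j |(χ′(x′)•R′_E(x′+e′_ν) − χ(πx′)•R_E(πx′+e_ν))_{ij}| ≤ |κ|(ε′ + ε)` — `O(η)`, no pairing estimate. [cite: Balaban1985BackgroundPropagators, (3.35) p.396, (3.51)–(3.52) p.400 (shapes)] -/
theorem rowSum_transporterRE_fit_le (W' T' : X' → Matrix κ κ ℝ) (S' : J → X' → Matrix κ κ ℝ) (hWS' : ∀ y, W' y * T' y * (W' (τ' ν y))ᵀ = S' ν y)
    (W T : X → Matrix κ κ ℝ) (S : J → X → Matrix κ κ ℝ) (hWS : ∀ y, W y * T y * (W (τ ν y))ᵀ = S ν y) (χ' : X' → ℝ) (χ : X → ℝ) {ε' ε : ℝ} (hε' : 0 ≤ ε') (hε : 0 ≤ ε)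
    (x' : X') (hal : χ' x' = χ (π x')) (hχ1 : |χ (π x')| ≤ 1) (hE1' : χ' x' ≠ 0 → ∀ i j, |(S' ν x' - 1) i j| ≤ ε') (hE1 : χ (π x') ≠ 0 → ∀ i j, |(S ν (π x') - 1) i j| ≤ ε) (i : κ) :
    ∑ j, |((fun x' => χ' x' • ((fun y => -(W' y * (T' ((τ' ν).symm y))ᵀ * (W' ((τ' ν).symm y))ᵀ)) ∘ ⇑(τ' ν)) x') x' -
        (fun x => χ x • ((fun y => -(W y * (T ((τ ν).symm y))ᵀ * (W ((τ ν).symm y))ᵀ)) ∘ ⇑(τ ν)) x) (π x')) i j| ≤ Fintype.card κ * (ε' + ε) := by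
  refine rowSum_le_card_mul_of_entry i fun j => ?_
  simp only []
  rw [transporterRE_shift_apply τ' ν W' T' S' hWS', transporterRE_shift_apply τ ν W T S hWS, hal]
  by_cases h0 : χ (π x') = 0
  · rw [h0, zero_smul, zero_smul, sub_self, Matrix.zero_apply, abs_zero]; positivity
  · have e1 : (χ (π x') • -(S' ν x')ᵀ - χ (π x') • -(S ν (π x'))ᵀ) i j = -(χ (π x') * ((S' ν x' - 1) j i - (S ν (π x') - 1) j i)) := by
      simp only [Matrix.sub_apply, Matrix.smul_apply, Matrix.neg_apply, Matrix.transpose_apply, Matrix.one_apply, smul_eq_mul]; ring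
    rw [e1, abs_neg, abs_mul]
    calc |χ (π x')| * |(S' ν x' - 1) j i - (S ν (π x') - 1) j i| ≤ 1 * (ε' + ε) :=
          mul_le_mul hχ1 ((abs_sub _ _).trans (add_le_add (hE1' (by rw [hal]; exact h0) j i) (hE1 h0 j i))) (abs_nonneg _) zero_le_one
      _ = ε' + ε := one_mul _

omit [DecidableEq κ] in
/-- ★★ **`hfRE′`**: `Σ_j |(χ′(x′)•∇′_νR′_E(x′) − χ(πx′)•∇_νR_E(πx′))_{ij}| ≤ |κ|(|n′|ε₂′ + |n|ε₂)` from the second letters `|(S′_ν(x′) − S′_ν(x′−e′_ν))_{ij}| ≤ ε₂′` (where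
`χ′(x′) ≠ 0`), `|(S_ν(πx′) − S_ν(πx′−e_ν))_{ij}| ≤ ε₂` (where `χ(πx′) ≠ 0`) — `O(η)`, no pairing estimate. [cite: Balaban1985BackgroundPropagators, (3.35) p.396, (3.51)–(3.52) p.400 (shapes)] -/
theorem rowSum_fgradMat_transporterRE_fit_le (W' T' : X' → Matrix κ κ ℝ) (S' : J → X' → Matrix κ κ ℝ) (hWS' : ∀ y, W' y * T' y * (W' (τ' ν y))ᵀ = S' ν y)
    (W T : X → Matrix κ κ ℝ) (S : J → X → Matrix κ κ ℝ) (hWS : ∀ y, W y * T y * (W (τ ν y))ᵀ = S ν y) (χ' : X' → ℝ) (χ : X → ℝ) (n' n : ℝ) {ε₂' ε₂ : ℝ} (hε' : 0 ≤ ε₂') (hε : 0 ≤ ε₂)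
    (x' : X') (hχ'1 : |χ' x'| ≤ 1) (hχ1 : |χ (π x')| ≤ 1) (hE2' : χ' x' ≠ 0 → ∀ i j, |(S' ν x' - S' ν ((τ' ν).symm x')) i j| ≤ ε₂') (hE2 : χ (π x') ≠ 0 → ∀ i j, |(S ν (π x') - S ν ((τ ν).symm (π x'))) i j| ≤ ε₂) (i : κ) :
    ∑ j, |((fun x' => χ' x' • (fgradMat n' (τ' ν) (fun y => -(W' y * (T' ((τ' ν).symm y))ᵀ * (W' ((τ' ν).symm y))ᵀ))) x') x' -
        (fun x => χ x • (fgradMat n (τ ν) (fun y => -(W y * (T ((τ ν).symm y))ᵀ * (W ((τ ν).symm y))ᵀ))) x) (π x')) i j| ≤ Fintype.card κ * (|n'| * ε₂' + |n| * ε₂) := by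
  refine rowSum_le_card_mul_of_entry i fun j => ?_
  simp only []
  rw [fgradMat_transporterRE_apply τ' ν W' T' S' hWS', fgradMat_transporterRE_apply τ ν W T S hWS, Matrix.sub_apply]
  have hA : |(χ' x' • -(n' • (S' ν x' - S' ν ((τ' ν).symm x')))ᵀ) i j| ≤ |n'| * ε₂' := by
    by_cases h0 : χ' x' = 0
    · rw [h0, zero_smul, Matrix.zero_apply, abs_zero]; positivity
    · rw [Matrix.smul_apply, Matrix.neg_apply, Matrix.transpose_apply, Matrix.smul_apply, smul_eq_mul, smul_eq_mul, abs_mul, abs_neg, abs_mul]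
      calc |χ' x'| * (|n'| * |(S' ν x' - S' ν ((τ' ν).symm x')) j i|) ≤ 1 * (|n'| * ε₂') := mul_le_mul hχ'1 (mul_le_mul_of_nonneg_left (hE2' h0 j i) (abs_nonneg _)) (by positivity) zero_le_one
        _ = |n'| * ε₂' := one_mul _
  have hB : |(χ (π x') • -(n • (S ν (π x') - S ν ((τ ν).symm (π x'))))ᵀ) i j| ≤ |n| * ε₂ := by
    by_cases h0 : χ (π x') = 0
    · rw [h0, zero_smul, Matrix.zero_apply, abs_zero]; positivity
    · rw [Matrix.smul_apply, Matrix.neg_apply, Matrix.transpose_apply, Matrix.smul_apply, smul_eq_mul, smul_eq_mul, abs_mul, abs_neg, abs_mul]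
      calc |χ (π x')| * (|n| * |(S ν (π x') - S ν ((τ ν).symm (π x'))) j i|) ≤ 1 * (|n| * ε₂) := mul_le_mul hχ1 (mul_le_mul_of_nonneg_left (hE2 h0 j i) (abs_nonneg _)) (by positivity) zero_le_one
        _ = |n| * ε₂ := one_mul _
  exact (abs_sub _ _).trans (add_le_add hA hB)

/-- ★★ **`hfBE` IS THE SHARP VALUE FIT OF `a⁻_ν`**: `Σ_j |(χ′(x′)•B′_E(x′) − χ(πx′)•B_E(πx′))_{ij}| = Σ_j |(χ′(x′)•a′⁻_ν(x′) − χ(πx′)•a⁻_ν(πx′))_{ij}|`.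
[cite: Balaban1985BackgroundPropagators, (3.51)–(3.52) p.400 (the backward coefficient: shape)] -/
theorem rowSum_transporterBE_fit_eq (W' T' : X' → Matrix κ κ ℝ) (S' : J → X' → Matrix κ κ ℝ) (hWS' : ∀ y, W' y * T' y * (W' (τ' ν y))ᵀ = S' ν y)
    (W T : X → Matrix κ κ ℝ) (S : J → X → Matrix κ κ ℝ) (hWS : ∀ y, W y * T y * (W (τ ν y))ᵀ = S ν y) (χ' : X' → ℝ) (χ : X → ℝ) {n' η' n η : ℝ} (hn' : η'⁻¹ = n') (hn : η⁻¹ = n)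
    (x' : X') (i : κ) :
    ∑ j, |((fun x' => χ' x' • (fun y => n' • (W' y * (T' ((τ' ν).symm y))ᵀ * (W' ((τ' ν).symm y))ᵀ - 1)) x') x' -
        (fun x => χ x • (fun y => n • (W y * (T ((τ ν).symm y))ᵀ * (W ((τ ν).symm y))ᵀ - 1)) x) (π x')) i j| =
      ∑ j, |(χ' x' • tCoefA η' (gaugePair τ' S') (Sum.inr ν) x' - χ (π x') • tCoefA η (gaugePair τ S) (Sum.inr ν) (π x')) i j| := by
  refine Finset.sum_congr rfl fun j _ => ?_
  simp only []
  rw [transporterBE_eq_neg_tCoefA_inr τ' ν W' T' S' hWS' hn', transporterBE_eq_neg_tCoefA_inr τ ν W T S hWS hn, smul_neg, smul_neg, neg_sub_neg, Matrix.sub_apply,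
    Matrix.sub_apply, abs_sub_comm]

end TransporterFits


end Summit.QuantumFields.YangMills.BalabanUVNodes.N15.Gluing

end
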